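import Summits.QuantumFields.BalabanUV.Beta.WilsonReflectionContact
import Summits.QuantumFields.BalabanUV.Beta.VhPieceReflection

/-!
# (Sr-conj) AT `j = 0` FOR THE WHOLE NATIVE-PLACEMENT SPINE `S0NAt`, every jet bond — and the normalisation it forces

HONEST FRAMING.  Discharging `BetaPertH` makes Balaban's ultraviolet stability UNCONDITIONAL — a real constructive-QFT
result; it is NOT the continuum limit and NOT the Clay problem.  This leaf is bookkeeping (cell pub-balaban, β sub-cell, lane an3 gen 28,
stage S4 of «WILSON-REFLECTION-WITH-CONTACT»; demand X-an2-45 §3 (ii)–(iii) ∕ (R45-4), BINDER-OWNERS row D1 (iii)): finite algebra over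
an3's `WilsonReflectionContact.wilsonA_bref` and an2's `VhPieceReflection` ∕ `LambdaPieceReflection` BY NAME; nothing cited, no `Prop`
fact, no binder of the β-function wall instantiated.

THE POINT.  an2's socket hSrC of `SpineRooted.axisReflectionCovariant_flipK_TbalOf_JsBalBmAtOf_ctrC` (and of its native twin) at `j = 0`
asks, for EVERY jet bond `(κ′, u)` and every axis `α`, for ONE diagonal contact generator `C`:

  `S κ′ (bref α κ′ u) = reflSign α κ′ • refK (Φ Lc α) (S κ′ u + conjV (bhKAt d ρ_c Lc) C)`.

For the native spine `S = S0NAt d Lc ρ_c cE cVH cΛ = cE • wilsonA + cVH • vhSAt ρ_c + cΛ • SLam …` the three slices are now kernel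
facts: the Λ-slice is pure sign (`S0NAt_lam_reflect`, an2), the vh-slice obeys the socket with `C = (cVH / Lc^{d+1}) • diagK (ctGen d α Lc κ′ u)`
on every block except the field–field one (`S0NAt_vh_bref_inl_inr ∕ _inr_inl ∕ _inr_inr`, an2 over an5), and the Wilson slice obeys it on
the field–field block with `C = (−cE/2) • diagK (ctGen …)` (`wilsonA_bref_inl_inl_conjV`, an3: `c_W = −½`).  HENCE:

* `S0NAt_bref_defect_inl_inl` — THE EXACT FIELD–FIELD DEFECT for an arbitrary coefficient triple: with an2's generator
  `(cVH / Lc^{d+1}) • diagK ctGen`, `LHS − RHS = −ε_κ′ ε_a ε_b · (cE/2 + cVH/Lc^{d+1}) · conjV (bhKAt) (diagK ctGen) (X, Z; a, b)` on the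
  field–field block (and `0` on the three other blocks: `S0NAt_bref_inl_inr ∕ _inr_inl ∕ _inr_inr` hold for every triple);
* **`S0NAt_bref`** — under the NORMALISATION RELATION `2 · cVH = −cE · Lc^{d+1}` the socket shape holds for the WHOLE spine at EVERY jet
  bond (also `κ′ = α`), with an2's single generator.

So, in the colourless kernel currency of the tree (an3's `wilsonA`, an5's `vhSAt`, an2's `ctGen`), hR at `j = 0` with one diagonal
generator holds iff `cVH : cE = −Lc^{d+1} : 2` — the field–field contact block is not identically zero: its entry at legs `(u, α; u, l)`,
`l ≠ α`, for the jet bond `(α, u)` equals `−2` (`conjV_bhKAt_ctGen_root_entry`, from `Lc_root_transverse : Lc e α u (u, l) = −1`), so for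
`d ≥ 1` the relation is FORCED — **`S0NAt_bref_iff`** (§4) — versus the working convention `(cE, cVH) = (1, −Lc^{d+1})` of journal l.4132,
which misses it by a factor `2`.  Which side carries the physical factor (the unit-colour normalisation of `StepJetData.wEntry`, or the
`𝒬 = Lc^{d+1} q¹` reading of the vh block) is for the row owner an2 ∕ an1 ∕ the β-lead to rule ((R45)); this file only records the kernel
identity both ways.
-/

namespace Summit.QuantumFields.BalabanUV.Beta.S0NAtReflection

open Finset
open scoped BigOperators
open Literature.MathematicalPhysics.QuantumFieldTheory.Balaban1983to89
open Literature.MathematicalPhysics.QuantumFieldTheory.Balaban1983to89.Beta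
open ExpKernelCalculus (MKer)
open AveragingContoursRooted (ctr)
open AveragingHessianKernels (packVH_inl_inl)
open AveragingHessianKernelsRooted (vhSAt)
open StepJetData (wilsonA)
open PolarizationSign (reflSign)
open KernelReflection (refK refK_apply)
open ResolventReflection (bref Φ Φ_r_inl Φ_r_inr Φ_s_inl Φ_s_inr)
open OneStepResolventKernel (Fib)
open Summit.QuantumFields.BalabanUV.Beta.ChartConjugation (conjV)
open Summit.QuantumFields.BalabanUV.Beta.BorderedHessian (bhKAt diagK ctGen)
open Summit.QuantumFields.BalabanUV.Beta.SpineRooted (S0NAt S0NAt_split S0NAt_vh_ctr_apply S0NAt_lam_reflect conjV_smul_right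
  S0NAt_vh_bref_inl_inr S0NAt_vh_bref_inr_inl S0NAt_vh_bref_inr_inr)
open Summit.QuantumFields.BalabanUV.Beta.WilsonReflectionContact (wilsonA_bref_inl_inl_conjV wilsonA_inl_inr wilsonA_inr_inl
  wilsonA_inr_inr)

noncomputable section

variable {d : ℕ} {Lc : ℕ} [NeZero Lc]

/-! ## §1 Slicing the native spine -/

/-- the Wilson∕Λ slice splits once more: `S0NAt ρ cE 0 cΛ κ′ u = cE • wilsonA κ′ u + S0NAt ρ 0 0 cΛ κ′ u`. [folklore] -/
theorem S0NAt_wl_split (ρ : Fin (d + 1) → ℤ) (cE cΛ : ℝ) (κ' : Fin (d + 1)) (u : Fin (d + 1) → ℤ) :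
    S0NAt d Lc ρ cE 0 cΛ κ' u = cE • wilsonA d κ' u + S0NAt d Lc ρ 0 0 cΛ κ' u := by
  funext x z a b
  simp only [S0NAt, Pi.add_apply, Pi.smul_apply, smul_eq_mul, zero_mul, zero_add, add_zero]

/-- the three-slice decomposition, entrywise: `S0NAt ρ cE cVH cΛ κ′ u = S0NAt ρ 0 cVH 0 κ′ u + cE • wilsonA κ′ u + S0NAt ρ 0 0 cΛ κ′ u`. [folklore] -/
theorem S0NAt_three (ρ : Fin (d + 1) → ℤ) (cE cVH cΛ : ℝ) (κ' : Fin (d + 1)) (u x z : Fin (d + 1) → ℤ) (a b : Fib d) :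
    S0NAt d Lc ρ cE cVH cΛ κ' u x z a b =
      S0NAt d Lc ρ 0 cVH 0 κ' u x z a b + cE * wilsonA d κ' u x z a b + S0NAt d Lc ρ 0 0 cΛ κ' u x z a b := by
  rw [S0NAt_split d Lc ρ cE cVH cΛ]
  show (S0NAt d Lc ρ 0 cVH 0 κ' u + S0NAt d Lc ρ cE 0 cΛ κ' u) x z a b = _
  rw [S0NAt_wl_split ρ cE cΛ κ' u]
  simp only [Pi.add_apply, Pi.smul_apply, smul_eq_mul]
  ring

/-- the vh-slice has no field–field block (centred root). [folklore] -/
theorem S0NAt_vh_ctr_inl_inl (cVH : ℝ) (κ' : Fin (d + 1)) (u x z : Fin (d + 1) → ℤ) (β β' : Fin (d + 1)) :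
    S0NAt d Lc (ctr (d + 1) Lc) 0 cVH 0 κ' u x z (Sum.inl β) (Sum.inl β') = 0 := by
  rw [S0NAt_vh_ctr_apply]
  simp only [AveragingHessianKernelsRooted.vhSAt, packVH_inl_inl, mul_zero]

/-- entries of the Λ-slice law `S0NAt_lam_reflect` (an2). [folklore] -/
theorem S0NAt_lam_bref_apply (hLc : Odd Lc) (cΛ : ℝ) (α κ' : Fin (d + 1)) (u x z : Fin (d + 1) → ℤ) (a b : Fib d) :
    S0NAt d Lc (ctr (d + 1) Lc) 0 0 cΛ κ' (bref α κ' u) x z a b =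
      reflSign α κ' * ((Φ (d := d) Lc α).s a * (Φ (d := d) Lc α).s b *
        S0NAt d Lc (ctr (d + 1) Lc) 0 0 cΛ κ' u ((Φ (d := d) Lc α).r a x) ((Φ (d := d) Lc α).r b z) a b) := by
  rw [S0NAt_lam_reflect hLc cΛ α κ' u]
  simp only [Pi.smul_apply, smul_eq_mul, refK_apply]

/-! ## §2 The law blockwise, for an arbitrary coefficient triple -/

/-- **FIELD–MULTIPLIER BLOCK**: the socket shape holds for every coefficient triple and every jet bond. [folklore] -/
theorem S0NAt_bref_inl_inr (hLc : Odd Lc) (cE cVH cΛ : ℝ) (α κ' : Fin (d + 1)) (u x z : Fin (d + 1) → ℤ) (β μ : Fin (d + 1)) :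
    S0NAt d Lc (ctr (d + 1) Lc) cE cVH cΛ κ' (bref α κ' u) x z (Sum.inl β) (Sum.inr μ) =
      (reflSign α κ' • refK (Φ Lc α) (S0NAt d Lc (ctr (d + 1) Lc) cE cVH cΛ κ' u +
        conjV (bhKAt d (ctr (d + 1) Lc) Lc) ((cVH / (Lc : ℝ) ^ (d + 1)) • diagK (ctGen d α Lc κ' u)))) x z (Sum.inl β) (Sum.inr μ) := by
  have hv := S0NAt_vh_bref_inl_inr hLc cVH α κ' u x z β μ
  rw [S0NAt_three, hv, S0NAt_lam_bref_apply hLc, wilsonA_inl_inr]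
  simp only [Pi.smul_apply, Pi.add_apply, smul_eq_mul, refK_apply, S0NAt_three _ cE cVH cΛ, wilsonA_inl_inr]
  ring

/-- **MULTIPLIER–FIELD BLOCK**: the socket shape holds for every coefficient triple and every jet bond. [folklore] -/
theorem S0NAt_bref_inr_inl (hLc : Odd Lc) (cE cVH cΛ : ℝ) (α κ' : Fin (d + 1)) (u x z : Fin (d + 1) → ℤ) (μ β : Fin (d + 1)) :
    S0NAt d Lc (ctr (d + 1) Lc) cE cVH cΛ κ' (bref α κ' u) x z (Sum.inr μ) (Sum.inl β) =
      (reflSign α κ' • refK (Φ Lc α) (S0NAt d Lc (ctr (d + 1) Lc) cE cVH cΛ κ' u +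
        conjV (bhKAt d (ctr (d + 1) Lc) Lc) ((cVH / (Lc : ℝ) ^ (d + 1)) • diagK (ctGen d α Lc κ' u)))) x z (Sum.inr μ) (Sum.inl β) := by
  have hv := S0NAt_vh_bref_inr_inl hLc cVH α κ' u x z μ β
  rw [S0NAt_three, hv, S0NAt_lam_bref_apply hLc, wilsonA_inr_inl]
  simp only [Pi.smul_apply, Pi.add_apply, smul_eq_mul, refK_apply, S0NAt_three _ cE cVH cΛ, wilsonA_inr_inl]
  ring

/-- **MULTIPLIER–MULTIPLIER BLOCK**: the socket shape holds for every coefficient triple and every jet bond. [folklore] -/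
theorem S0NAt_bref_inr_inr (hLc : Odd Lc) (cE cVH cΛ : ℝ) (α κ' : Fin (d + 1)) (u x z : Fin (d + 1) → ℤ) (μ μ' : Fin (d + 1)) :
    S0NAt d Lc (ctr (d + 1) Lc) cE cVH cΛ κ' (bref α κ' u) x z (Sum.inr μ) (Sum.inr μ') =
      (reflSign α κ' • refK (Φ Lc α) (S0NAt d Lc (ctr (d + 1) Lc) cE cVH cΛ κ' u +
        conjV (bhKAt d (ctr (d + 1) Lc) Lc) ((cVH / (Lc : ℝ) ^ (d + 1)) • diagK (ctGen d α Lc κ' u)))) x z (Sum.inr μ) (Sum.inr μ') := by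
  have hv := S0NAt_vh_bref_inr_inr hLc cVH α κ' u x z μ μ'
  rw [S0NAt_three, hv, S0NAt_lam_bref_apply hLc, wilsonA_inr_inr]
  simp only [Pi.smul_apply, Pi.add_apply, smul_eq_mul, refK_apply, S0NAt_three _ cE cVH cΛ, wilsonA_inr_inr]
  ring

/-- **THE FIELD–FIELD DEFECT, EXACTLY**: for an arbitrary coefficient triple and every jet bond, with an2's generator
`(cVH / Lc^{d+1}) • diagK ctGen`, `LHS − RHS` on the field–field block is `−ε_κ′ ε_a ε_b · (cE/2 + cVH/Lc^{d+1}) · conjV (bhKAt) (diagK ctGen) (X, Z; a, b)`,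
`X = bref α a x`, `Z = bref α b z`. [folklore] -/
theorem S0NAt_bref_defect_inl_inl (hLc : Odd Lc) (cE cVH cΛ : ℝ) (α κ' : Fin (d + 1)) (u x z : Fin (d + 1) → ℤ)
    (β β' : Fin (d + 1)) :
    S0NAt d Lc (ctr (d + 1) Lc) cE cVH cΛ κ' (bref α κ' u) x z (Sum.inl β) (Sum.inl β') -
      (reflSign α κ' • refK (Φ Lc α) (S0NAt d Lc (ctr (d + 1) Lc) cE cVH cΛ κ' u +
        conjV (bhKAt d (ctr (d + 1) Lc) Lc) ((cVH / (Lc : ℝ) ^ (d + 1)) • diagK (ctGen d α Lc κ' u)))) x z (Sum.inl β) (Sum.inl β') =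
      -(reflSign α κ' * reflSign α β * reflSign α β' * (cE / 2 + cVH / (Lc : ℝ) ^ (d + 1)) *
        conjV (bhKAt d (ctr (d + 1) Lc) Lc) (diagK (ctGen d α Lc κ' u)) (bref α β x) (bref α β' z) (Sum.inl β) (Sum.inl β')) := by
  rw [S0NAt_three, S0NAt_vh_ctr_inl_inl, S0NAt_lam_bref_apply hLc, wilsonA_bref_inl_inl_conjV Lc]
  simp only [Pi.smul_apply, Pi.add_apply, smul_eq_mul, refK_apply, S0NAt_three _ cE cVH cΛ, S0NAt_vh_ctr_inl_inl, Φ_s_inl, Φ_r_inl,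
    conjV_smul_right]
  ring

/-! ## §3 The socket shape for the whole spine under the normalisation relation -/

/-- **FIELD–FIELD BLOCK UNDER THE NORMALISATION RELATION** `2 · cVH = −cE · Lc^{d+1}`. [folklore] -/
theorem S0NAt_bref_inl_inl (hLc : Odd Lc) {cE cVH : ℝ} (cΛ : ℝ) (hn : 2 * cVH = -(cE * (Lc : ℝ) ^ (d + 1)))
    (α κ' : Fin (d + 1)) (u x z : Fin (d + 1) → ℤ) (β β' : Fin (d + 1)) :
    S0NAt d Lc (ctr (d + 1) Lc) cE cVH cΛ κ' (bref α κ' u) x z (Sum.inl β) (Sum.inl β') =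
      (reflSign α κ' • refK (Φ Lc α) (S0NAt d Lc (ctr (d + 1) Lc) cE cVH cΛ κ' u +
        conjV (bhKAt d (ctr (d + 1) Lc) Lc) ((cVH / (Lc : ℝ) ^ (d + 1)) • diagK (ctGen d α Lc κ' u)))) x z (Sum.inl β) (Sum.inl β') := by
  have hL : ((Lc : ℝ) ^ (d + 1)) ≠ 0 := pow_ne_zero _ (by exact_mod_cast NeZero.ne Lc)
  have hγ : cE / 2 + cVH / (Lc : ℝ) ^ (d + 1) = 0 := by
    rw [div_add_div _ _ two_ne_zero hL, div_eq_zero_iff]; left; linarith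
  have h := S0NAt_bref_defect_inl_inl hLc cE cVH cΛ α κ' u x z β β'
  rw [hγ] at h
  simpa only [mul_zero, zero_mul, neg_zero, sub_eq_zero] using h

/-- **(Sr-conj) AT `j = 0` FOR THE WHOLE NATIVE SPINE, EVERY JET BOND** (centred root, `Lc` odd): under `2 · cVH = −cE · Lc^{d+1}`,
`S0NAt d Lc ρ_c cE cVH cΛ κ′ (bref α κ′ u) = reflSign α κ′ • refK (Φ Lc α) (S0NAt … κ′ u + conjV (bhKAt d ρ_c Lc) ((cVH / Lc^{d+1}) • diagK (ctGen d α Lc κ′ u)))`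
— EXACTLY the shape of the hypothesis hSrC, Wilson slice included. [folklore] -/
theorem S0NAt_bref (hLc : Odd Lc) {cE cVH : ℝ} (cΛ : ℝ) (hn : 2 * cVH = -(cE * (Lc : ℝ) ^ (d + 1))) (α κ' : Fin (d + 1))
    (u : Fin (d + 1) → ℤ) :
    S0NAt d Lc (ctr (d + 1) Lc) cE cVH cΛ κ' (bref α κ' u) =
      reflSign α κ' • refK (Φ Lc α) (S0NAt d Lc (ctr (d + 1) Lc) cE cVH cΛ κ' u +
        conjV (bhKAt d (ctr (d + 1) Lc) Lc) ((cVH / (Lc : ℝ) ^ (d + 1)) • diagK (ctGen d α Lc κ' u))) := by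
  funext x z a b
  rcases a with β | μ <;> rcases b with β' | μ'
  · exact S0NAt_bref_inl_inl hLc cΛ hn α κ' u x z β β'
  · exact S0NAt_bref_inl_inr hLc cE cVH cΛ α κ' u x z β μ'
  · exact S0NAt_bref_inr_inl hLc cE cVH cΛ α κ' u x z μ β'
  · exact S0NAt_bref_inr_inr hLc cE cVH cΛ α κ' u x z μ μ'

/-- **THE SAME WITH THE WILSON WEIGHT AS THE FREE PARAMETER**: `cVH := −(cE/2) · Lc^{d+1}`, generator `(−cE/2) • diagK ctGen`. [folklore] -/
theorem S0NAt_bref' (hLc : Odd Lc) (cE cΛ : ℝ) (α κ' : Fin (d + 1)) (u : Fin (d + 1) → ℤ) :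
    S0NAt d Lc (ctr (d + 1) Lc) cE (-(cE / 2) * (Lc : ℝ) ^ (d + 1)) cΛ κ' (bref α κ' u) =
      reflSign α κ' • refK (Φ Lc α) (S0NAt d Lc (ctr (d + 1) Lc) cE (-(cE / 2) * (Lc : ℝ) ^ (d + 1)) cΛ κ' u +
        conjV (bhKAt d (ctr (d + 1) Lc) Lc) ((-(cE / 2)) • diagK (ctGen d α Lc κ' u))) := by
  have hL : ((Lc : ℝ) ^ (d + 1)) ≠ 0 := pow_ne_zero _ (by exact_mod_cast NeZero.ne Lc)
  have hγ : -(cE / 2) * (Lc : ℝ) ^ (d + 1) / (Lc : ℝ) ^ (d + 1) = -(cE / 2) := mul_div_cancel_right₀ _ hL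
  have h := S0NAt_bref hLc (cE := cE) (cVH := -(cE / 2) * (Lc : ℝ) ^ (d + 1)) cΛ (by ring) α κ' u
  rwa [hγ] at h

/-- **THE `bhK`-UNIT INSTANCE** (FINDING X-an3-28-1, Addendum 1): with the Wilson weight `cE = 2` (the field block of
`BorderedHessian.bhK` is `curvAdj ∘ curv = 2·curl†curl`, `WilsonReflectionContact.curvAdj_curv_delta1_eq_two_mul_Lc`) and an1's
`cVH = −Lc^{d+1}`, the socket law holds with an2's generator at coefficient `−1`:
`S0NAt … 2 (−Lc^{d+1}) cΛ κ′ (bref α κ′ u) = reflSign α κ′ • refK (Φ Lc α) (S0NAt … κ′ u + conjV (bhKAt) ((−1) • diagK ctGen))`. [folklore] -/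
theorem S0NAt_bref_two (hLc : Odd Lc) (cΛ : ℝ) (α κ' : Fin (d + 1)) (u : Fin (d + 1) → ℤ) :
    S0NAt d Lc (ctr (d + 1) Lc) 2 (-((Lc : ℝ) ^ (d + 1))) cΛ κ' (bref α κ' u) =
      reflSign α κ' • refK (Φ Lc α) (S0NAt d Lc (ctr (d + 1) Lc) 2 (-((Lc : ℝ) ^ (d + 1))) cΛ κ' u +
        conjV (bhKAt d (ctr (d + 1) Lc) Lc) ((-1 : ℝ) • diagK (ctGen d α Lc κ' u))) := by
  have hL : ((Lc : ℝ) ^ (d + 1)) ≠ 0 := pow_ne_zero _ (by exact_mod_cast NeZero.ne Lc)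
  have hγ : -((Lc : ℝ) ^ (d + 1)) / (Lc : ℝ) ^ (d + 1) = (-1 : ℝ) := by rw [neg_div, div_self hL]
  have h := S0NAt_bref hLc (cE := 2) (cVH := -((Lc : ℝ) ^ (d + 1))) cΛ (by ring) α κ' u
  rwa [hγ] at h

end

end Summit.QuantumFields.BalabanUV.Beta.S0NAtReflection

namespace Summit.QuantumFields.BalabanUV.Beta.S0NAtReflection

open Finset
open scoped BigOperators
open Literature.MathematicalPhysics.QuantumFieldTheory.Balaban1983to89
open Literature.MathematicalPhysics.QuantumFieldTheory.Balaban1983to89.Beta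
open PlaquetteVertex (lcurl bondLetter)
open ExpKernelCalculus (MKer)
open AveragingContoursRooted (ctr)
open AffineAveraging (curv curvAdj)
open KKTFluctuationKernel (delta1)
open B6BondElimination (unitVec unitVec_apply)
open PolarizationSign (reflSign)
open KernelReflection (refK refK_apply)
open ResolventReflection (bref bref_bref Φ reflSign_mul_self)
open OneStepResolventKernel (Fib)
open Summit.QuantumFields.BalabanUV.Beta.ChartConjugation (conjV)
open Summit.QuantumFields.BalabanUV.Beta.BorderedHessian (bhKAt diagK ctGen)
open Summit.QuantumFields.BalabanUV.Beta.SpineRooted (S0NAt)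
open Summit.QuantumFields.BalabanUV.Beta.WilsonReflectionFrame (Lc)
open Summit.QuantumFields.BalabanUV.Beta.WilsonReflectionContact (wilsonCt_inl_inl wilsonCt_inl_inl_eq_conjV
  curvAdj_curv_delta1_eq_two_mul_Lc)

/-! ## §4 The normalisation relation is FORCED: an explicit non-zero entry of the field–field contact block -/

section Forced

variable {d : ℕ}

/-- a unit lattice vector is not zero: `u - e_ν ≠ u`. [folklore] -/
theorem sub_unitVec_ne (u : Fin (d + 1) → ℤ) (ν : Fin (d + 1)) : u - unitVec ν ≠ u := by
  intro h
  have e := congrFun h ν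
  simp only [Pi.sub_apply, unitVec_apply, if_true] at e
  omega

/-- a unit lattice vector is not zero: `u + e_ν ≠ u`. [folklore] -/
theorem add_unitVec_ne (u : Fin (d + 1) → ℤ) (ν : Fin (d + 1)) : u + unitVec ν ≠ u := by
  intro h
  have e := congrFun h ν
  simp only [Pi.add_apply, unitVec_apply, if_true] at e
  omega

/-- distinct unit lattice vectors are distinct: `u - e_ν + e_α = u → ν = α`. [folklore] -/
theorem eq_of_sub_unitVec_add_unitVec_eq (u : Fin (d + 1) → ℤ) {ν α : Fin (d + 1)} (h : u - unitVec ν + unitVec α = u) : ν = α := by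
  by_contra hne
  have e := congrFun h ν
  simp only [Pi.add_apply, Pi.sub_apply, unitVec_apply, if_true, if_neg hne] at e
  omega

/-- **THE CONTACT COEFFICIENT AT THE ROOT BOND**: for a transverse direction `l ≠ α`, `Lc e α u (u, l) = −1` (`e = unitVec`):
of the `2(d+1)` curl evaluations in its definition exactly one indicator survives. [folklore] -/
theorem Lc_root_transverse {α l : Fin (d + 1)} (hl : l ≠ α) (u : Fin (d + 1) → ℤ) : Lc unitVec α u (u, l) = -1 := by
  have hαl : ¬(α = l) := fun h => hl h.symm
  unfold Lc
  have hsum : ∀ ν : Fin (d + 1), lcurl unitVec (bondLetter u l (1 : ℝ)) (u - unitVec ν) ν α -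
      lcurl unitVec (bondLetter u l (1 : ℝ)) u ν α = -(if ν = l then 1 else 0) := by
    intro ν
    have h3 : ¬(u - unitVec ν + unitVec α = u ∧ ν = l) := by
      rintro ⟨h, rfl⟩; exact hl (eq_of_sub_unitVec_add_unitVec_eq u h)
    simp only [lcurl, bondLetter, sub_add_cancel, hαl, and_false, if_false, sub_unitVec_ne u ν, add_unitVec_ne u ν,
      add_unitVec_ne u α, false_and, true_and, h3, zero_sub, sub_self]
    split_ifs <;> ring
  rw [Finset.sum_congr rfl fun ν _ => hsum ν, Finset.sum_neg_distrib, Finset.sum_ite_eq' Finset.univ l, if_pos (Finset.mem_univ l)]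

/-- **AN EXPLICIT NON-ZERO ENTRY OF THE FIELD–FIELD CONTACT BLOCK**: at the jet bond `(α, u)` parallel to the reflected axis, the
entry of an2's `conjV (bhKAt) (diagK ctGen)` at legs `(u, α; u, l)`, `l ≠ α`, equals `−2` (every window parameter `L`). [folklore] -/
theorem conjV_bhKAt_ctGen_root_entry (L : ℕ) {α l : Fin (d + 1)} (hl : l ≠ α) (u : Fin (d + 1) → ℤ) :
    conjV (bhKAt d (ctr (d + 1) L) L) (diagK (ctGen d α L α u)) u u (Sum.inl α) (Sum.inl l) = -2 := by
  rw [← wilsonCt_inl_inl_eq_conjV, wilsonCt_inl_inl, curvAdj_curv_delta1_eq_two_mul_Lc, Lc_root_transverse hl]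
  simp only [if_true, and_self, hl, and_false, if_false]
  ring

variable {Lc : ℕ} [NeZero Lc]

/-- **THE NORMALISATION RELATION IS FORCED**: for `Lc` odd and any axis `α` with a transverse direction `l ≠ α` (i.e. `d ≥ 1`), the
socket shape hSrC with an2's single diagonal generator holds for every jet bond `(κ′, u)` IF AND ONLY IF `2 · cVH = −cE · Lc^{d+1}`. [folklore] -/
theorem S0NAt_bref_iff (hLc : Odd Lc) {α l : Fin (d + 1)} (hl : l ≠ α) (cE cVH cΛ : ℝ) :
    (∀ (κ' : Fin (d + 1)) (u : Fin (d + 1) → ℤ), S0NAt d Lc (ctr (d + 1) Lc) cE cVH cΛ κ' (bref α κ' u) =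
        reflSign α κ' • refK (Φ Lc α) (S0NAt d Lc (ctr (d + 1) Lc) cE cVH cΛ κ' u +
          conjV (bhKAt d (ctr (d + 1) Lc) Lc) ((cVH / (Lc : ℝ) ^ (d + 1)) • diagK (ctGen d α Lc κ' u)))) ↔
      2 * cVH = -(cE * (Lc : ℝ) ^ (d + 1)) := by
  constructor
  · intro h
    have hL : ((Lc : ℝ) ^ (d + 1)) ≠ 0 := pow_ne_zero _ (by exact_mod_cast NeZero.ne Lc)
    obtain ⟨u⟩ : Nonempty (Fin (d + 1) → ℤ) := ⟨0⟩
    have hdef := S0NAt_bref_defect_inl_inl hLc cE cVH cΛ α α u (bref α α u) (bref α l u) α l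
    rw [h α u, sub_self, bref_bref, bref_bref, conjV_bhKAt_ctGen_root_entry Lc hl u] at hdef
    have hs₁ := reflSign_mul_self α α
    have hs₂ := reflSign_mul_self α l
    have key : cE / 2 + cVH / (Lc : ℝ) ^ (d + 1) = 0 := by
      have h0 : reflSign α α * reflSign α α * reflSign α l * (cE / 2 + cVH / (Lc : ℝ) ^ (d + 1)) * (-2) = 0 := by
        linarith
      rw [hs₁, one_mul] at h0
      rcases mul_eq_zero.1 h0 with h1 | h1
      · rcases mul_eq_zero.1 h1 with h2 | h2
        · exfalso
          have : reflSign α l * reflSign α l = 0 := by rw [h2, zero_mul]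
          rw [hs₂] at this
          exact one_ne_zero this
        · exact h2
      · norm_num at h1
    field_simp at key
    linarith
  · intro hn κ' u
    exact S0NAt_bref hLc cΛ hn α κ' u

end Forced

end Summit.QuantumFields.BalabanUV.Beta.S0NAtReflection
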